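import Literature.Probability.Percolation.QSMLift
import Literature.Probability.Percolation.GrimmettMarstrand
import Literature.Probability.Percolation.KestenTheoremProofs
import Literature.Probability.Percolation.BernoulliPercolationProofs
import HarnessLib

/-!
# `p_c(ℤ³) < p_c(C_n □ ℤ²)`: discharge of `martineauSevero_zd3_slabTorus` (Martineau–Severo 2019)

Final file of the inline proof of the named fact
`Literature.Probability.Percolation.martineauSevero_zd3_slabTorus`
(S. Martineau, F. Severo, *Strict monotonicity of percolation thresholds under covering maps*,
Ann. Probab. 47 (2019), Cor. 2.2 with Thm. 2.1, for `𝒢 = ℤ³`, `G = nℤ` acting by vertical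
translations, `ℋ = 𝒢/G = C_n □ ℤ² = slabTorusGraph n`, `n ≥ 3`).

The proof assembled here is Martineau–Severo's proof of Theorem 2.1 (§4) from their two
propositions, both established in the preceding files for the column version of their enhancement:

* **Proposition 4.1** (coupling, §5): `θ_ℋ`-type probabilities of the `(p, s)`-enhanced model with
  `s = p^{8n}` are dominated by cluster probabilities of `p`-percolation on `ℤ³`:
  `Θ_L(p, p^{8n}) = P_{GI,p}(ReachState) = P_{ℤ³,p}(ReachState) ≤ P_{ℤ³,p}(FarEv L)`
  (`measureReal_reachState_I`, `measureReal_setOf_bt_eq`, `setOf_reachState_subset_far`).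
* **Proposition 4.2** (essential enhancement, §6): for every `s > 0` there is `p_s < p_c(ℋ)` with
  the enhanced model percolating — here in the finite-volume form
  `Θ_L(p₀ - κ s', s') ≥ Θ_L(p₀, 0) ≥ θ_ℋ(p₀) > 0` for `p₀ > p_c(ℋ)` uniformly in `L`
  (`theta_line_mono` from the Aizenman–Grimmett inequality `sum_piv_inl_le` and Lemma 6.1
  `local_modification`; `theta_le_theta_zero`).

and the conclusion "`𝒞_𝒢^p(o')` is infinite with positive probability, so that
`p_c(𝒢) ≤ p < p_c(ℋ)`" is `theta_zd3_pos_of` below (continuity from above along the events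
`FarEv L ∩ {ω ⊆ E(ℤ³)}`, which decrease to a sub-event of `{|C(0)| = ∞}`).

Also proved here: `ℋ_n` is connected (so `p_c(ℋ_n, v)` does not depend on `v`,
`criticalProb_eq_of_reachable`), `p_c(ℋ_n) ≥ p_c(ℤ³) > 0` (the Benjamini–Schramm direction, read off
the same coupling at `s = 0`) and `p_c(ℋ_n) ≤ p_c(ℤ²) = 1/2 < 1` (`ℋ_n` contains a copy of `ℤ²`;
Kesten).

## References

* S. Martineau, F. Severo, Ann. Probab. 47 (2019), §2 Thm. 2.1, Cor. 2.2; §4 (proof of Thm. 2.1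
  from Props. 4.1, 4.2) [MartineauSevero2019].
* I. Benjamini, O. Schramm, Electron. Comm. Probab. 1 (1996), Thm. 1 [BenjaminiSchramm1996].
* M. Aizenman, G. Grimmett, J. Stat. Phys. 63 (1991) 817–835 [AizenmanGrimmett1991].
-/

set_option synthInstance.maxSize 1024

namespace Literature.Probability.Percolation

open LatticeModels MeasureTheory ProbeHistory
open scoped ENNReal

namespace SlabTorus

variable {n : ℕ}

/-! ### `ℋ_n` is connected; it contains `ℤ²`; `0 < p_c(ℋ_n) < 1` -/

/-- `ℋ_n` is connected (horizontal moves as in `ℤ²`, vertical moves around the cycle).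
[cite: MartineauSevero2019, §2 (Convention: graphs are connected)] -/
theorem reachable_origin [NeZero n] (hn : n ≠ 1) (v : Vert n) : (slabTorusGraph n).Reachable (origin n) v := by
  -- first horizontally to `(0, v.2)`, then vertically
  have h1' : ∀ {y y' : Site 2} (w : (zdGraph 2).Walk y y'),
      (slabTorusGraph n).Reachable (((0 : ZMod n)), y) (((0 : ZMod n)), y') := by
    intro y y' w
    induction w with
    | nil => rfl
    | @cons a b c hab _ ih =>
      exact (SimpleGraph.Adj.reachable (adj_horizontal (0 : ZMod n) hab)).trans ih
  have h1 : (slabTorusGraph n).Reachable (origin n) ((0 : ZMod n), v.2) := by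
    obtain ⟨w⟩ := zdGraph_reachable (0 : Site 2) v.2
    exact h1' w
  have h2 : ∀ k : ℕ, (slabTorusGraph n).Reachable ((0 : ZMod n), v.2) (((k : ZMod n)), v.2) := by
    intro k
    induction k with
    | zero => simp
    | succ k ih =>
      refine ih.trans (SimpleGraph.Adj.reachable ?_)
      push_cast
      exact adj_vertical hn _ _
  obtain ⟨k, hk⟩ := exists_eq_add_natCast (0 : ZMod n) v.1
  rw [zero_add] at hk
  have : v = (((k : ZMod n)), v.2) := by ext <;> simp [hk]
  rw [this]
  exact h1.trans (h2 k)

/-- The planar layer `{0} × ℤ²` of `ℋ_n` is a copy of `ℤ²`: `(slabTorusGraph n).comap (0, ·) = zdGraph 2`.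
[folklore] -/
theorem comap_layer (n : ℕ) : (slabTorusGraph n).comap (fun y : Site 2 => (((0 : ZMod n)), y)) = zdGraph 2 := by
  ext y y'
  simp only [SimpleGraph.comap_adj]
  constructor
  · intro h
    rcases adj_cases h with ⟨-, h⟩ | ⟨-, h, -⟩
    · exact h
    · exact absurd rfl h
  · intro h
    exact adj_horizontal _ h

/-- **`θ_{ℤ²}(0, p) ≤ θ_{ℋ_n}(o, p)`** (restriction coupling to the planar layer). [folklore] -/
theorem theta_zd2_le_theta (n : ℕ) (p : unitInterval) : theta (zdGraph 2) (0 : Site 2) p ≤ theta (slabTorusGraph n) (origin n) p := by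
  have hf : Function.Injective (fun y : Site 2 => ((((0 : ZMod n)), y) : Vert n)) := fun y y' h => by
    simpa using congrArg Prod.snd h
  have := theta_comap_le (slabTorusGraph n) hf (0 : Site 2) p
  rwa [comap_layer] at this

/-- **`p_c(ℋ_n, o) ≤ 1/2`** (it contains `ℤ²`, and `p_c(ℤ²) = 1/2`, Kesten). [folklore] -/
theorem criticalProb_le_half (n : ℕ) : criticalProb (slabTorusGraph n) (origin n) ≤ 1 / 2 := by
  rw [← kesten_criticalProb_Z2_holds]
  exact criticalProb_le_of_theta_pos_imp fun p hp => hp.trans_le (theta_zd2_le_theta n p)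

/-! ### Proposition 4.1 as an inequality between probabilities -/

section Coupling

variable [NeZero n]

/-- **Proposition 4.1 (for every `L`)**: `Θ_L(p, p^{8n}) ≤ P_p^{ℤ³}(FarEv L)`: the finite-volume
probability of the `(p, p^{8n})` column model is the probability of the transcript event of the
`ℋ`-side run, equal to that of the `ℤ³`-side run, which is contained in `FarEv L`.
[cite: MartineauSevero2019, §4 (Proposition 4.1)] -/
theorem theta_le_measureReal_far (hn : n ≠ 1) (L : ℕ) (p : unitInterval) :
    Theta n L p ((p : ℝ) ^ (8 * n)) ≤ (bondPercolation (zdGraph 3) p).real (FarEv L) := by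
  set k := (KE n L).card + (box 2 L).card + 1 with hk
  have hk' : (KE n L).card + (box 2 L).card < k := by omega
  rw [← measureReal_reachState_I hn L (8 * n) k hk' p,
    measureReal_setOf_bt_eq p (goodEnc_I (n := n) hn L (8 * n)) (goodEnc_II (n := n) L) k
      (fun b => ReachState L (stateOf (n := n) L b))]
  exact measureReal_mono (setOf_reachState_subset_far (n := n) L k)

end Coupling

/-! ### From `FarEv L` for all `L` to an infinite cluster -/

/-- The tails of adjacent points of `ℤ³` are equal or adjacent in `ℤ²`. [folklore] -/
theorem tail3_adj_or_eq {x x' : Site 3} (h : (zdGraph 3).Adj x x') : tail3 x = tail3 x' ∨ (zdGraph 2).Adj (tail3 x) (tail3 x') := by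
  rcases (zdGraph_three_adj_iff_tail x x').1 h with ⟨-, h⟩ | ⟨h, -⟩
  · exact Or.inr h
  · exact Or.inl h

/-- Along an open lattice path from `0`, the planar sup-norm takes every value up to that of the
endpoint: if the endpoint has sup-norm `≥ L + 1`, some reachable point has sup-norm exactly `L + 1`.
[folklore] -/
theorem exists_reachable_pnorm_eq {ω : Set (Sym2 (Site 3))} (hω : ω ⊆ (zdGraph 3).edgeSet) {L : ℕ}
    {u x : Site 3} (w : (openGraph ω).Walk u x) (hu : (openGraph ω).Reachable 0 u) (huL : pnorm (tail3 u) ≤ L + 1)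
    (hx : L + 1 ≤ pnorm (tail3 x)) : ∃ z : Site 3, (openGraph ω).Reachable 0 z ∧ pnorm (tail3 z) = L + 1 := by
  induction w with
  | nil => exact ⟨_, hu, le_antisymm huL hx⟩
  | @cons a b c hab _ ih =>
    by_cases ha : pnorm (tail3 a) = L + 1
    · exact ⟨a, hu, ha⟩
    · have haL : pnorm (tail3 a) ≤ L := by omega
      rw [openGraph_adj] at hab
      have hadj : (zdGraph 3).Adj a b := hω hab.1
      have hbL : pnorm (tail3 b) ≤ L + 1 := by
        rcases tail3_adj_or_eq hadj with h | h
        · rw [← h]; omega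
        · exact (pnorm_le_succ_of_adj h).trans (by omega)
      refine ih (hu.trans (SimpleGraph.Adj.reachable ?_)) hbL hx
      rw [openGraph_adj]; exact hab

/-- The events `FarEv L ∩ {ω ⊆ E(ℤ³)}` decrease in `L`. [folklore] -/
theorem farEv_inter_antitone : Antitone fun L : ℕ => FarEv L ∩ {ω : Set (Sym2 (Site 3)) | ω ⊆ (zdGraph 3).edgeSet} := by
  intro L L' hLL' ω hω
  obtain ⟨⟨x, hx, hxL⟩, hωE⟩ := hω
  refine ⟨?_, hωE⟩
  obtain ⟨w⟩ := hx
  have h0 : pnorm (tail3 (0 : Site 3)) ≤ L + 1 := by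
    have : tail3 (0 : Site 3) = 0 := by funext i; rfl
    rw [this, pnorm_zero]; exact Nat.zero_le _
  obtain ⟨z, hz, hzL⟩ := exists_reachable_pnorm_eq hωE (L := L) w SimpleGraph.Reachable.rfl h0 (by rw [hxL]; omega)
  exact ⟨z, hz, hzL⟩

/-- Reaching arbitrarily far planar sup-norms forces an infinite open cluster at `0`. [folklore] -/
theorem iInter_farEv_subset : (⋂ L : ℕ, (FarEv L ∩ {ω : Set (Sym2 (Site 3)) | ω ⊆ (zdGraph 3).edgeSet})) ⊆ percolatesAt (0 : Site 3) := by
  intro ω hω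
  rw [Set.mem_iInter] at hω
  by_contra hfin
  have hfin' : (openCluster ω (0 : Site 3)).Finite := Set.not_infinite.1 hfin
  -- the planar sup-norm is bounded on the finite cluster
  obtain ⟨M, hM⟩ : ∃ M : ℕ, ∀ x ∈ openCluster ω (0 : Site 3), pnorm (tail3 x) ≤ M := by
    obtain ⟨s, hs⟩ := hfin'.exists_finset_coe
    refine ⟨s.sup fun x => pnorm (tail3 x), fun x hx => ?_⟩
    have hx' : x ∈ s := by rw [← Finset.mem_coe, hs]; exact hx
    exact Finset.le_sup (f := fun x => pnorm (tail3 x)) hx'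
  obtain ⟨⟨x, hx, hxL⟩, -⟩ := hω M
  have := hM x hx
  omega

/-- `FarEv L` is measurable. [folklore] -/
theorem measurableSet_farEv (L : ℕ) : MeasurableSet (FarEv L) := by
  have : FarEv L = ⋃ x : Site 3, (if pnorm (tail3 x) = L + 1 then openConn (0 : Site 3) x else ∅) := by
    ext ω
    simp only [FarEv, Set.mem_setOf_eq, Set.mem_iUnion]
    constructor
    · rintro ⟨x, hx, hxL⟩
      exact ⟨x, by rw [if_pos hxL]; exact hx⟩
    · rintro ⟨x, hx⟩
      split_ifs at hx with h
      · exact ⟨x, hx, h⟩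
      · simp at hx
  rw [this]
  refine MeasurableSet.iUnion fun x => ?_
  split_ifs
  · exact measurableSet_openConn_holds _ _
  · exact MeasurableSet.empty

/-- **"`𝒞_𝒢^p(o')` is infinite with positive probability"**: if `P_p^{ℤ³}(FarEv L) ≥ η > 0` for all
`L`, then `θ_{ℤ³}(0, p) ≥ η > 0` (continuity from above along the decreasing events
`FarEv L ∩ {ω ⊆ E}`, whose intersection forces an infinite cluster; `{ω ⊆ E}` has full measure).
[cite: MartineauSevero2019, §4 (proof of Theorem 2.1, last step)] -/
theorem theta_zd3_pos_of (p : unitInterval) {η : ℝ} (hη : 0 < η)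
    (h : ∀ L : ℕ, η ≤ (bondPercolation (zdGraph 3) p).real (FarEv L)) : 0 < theta (zdGraph 3) (0 : Site 3) p := by
  set μ := bondPercolation (zdGraph 3) p with hμ
  set good : Set (BondConfig (Site 3)) := {ω | ω ⊆ (zdGraph 3).edgeSet} with hgood
  have hgood1 : ∀ᵐ ω ∂μ, ω ∈ good := ProbabilityTheory.setBernoulli_ae_subset (u := (zdGraph 3).edgeSet) (p := p)
  have hgood0 : μ goodᶜ = 0 := by
    rw [ae_iff] at hgood1
    exact hgood1
  have hinter : ∀ L, μ (FarEv L ∩ good) = μ (FarEv L) := fun L => measure_inter_conull hgood0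
  have hanti := farEv_inter_antitone
  have hgoodm : NullMeasurableSet good μ := by
    have := (NullMeasurableSet.of_null hgood0).compl
    rwa [compl_compl] at this
  have hmeas : ∀ L : ℕ, NullMeasurableSet (FarEv L ∩ good) μ := fun L =>
    ((measurableSet_farEv L).nullMeasurableSet).inter hgoodm
  have hiInter : μ (⋂ L : ℕ, (FarEv L ∩ good)) = ⨅ L : ℕ, μ (FarEv L ∩ good) :=
    hanti.measure_iInter hmeas ⟨0, measure_ne_top _ _⟩
  have hge : ENNReal.ofReal η ≤ μ (⋂ L : ℕ, (FarEv L ∩ good)) := by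
    rw [hiInter]
    refine le_iInf fun L => ?_
    rw [hinter L, ← ofReal_measureReal (measure_ne_top _ _)]
    exact ENNReal.ofReal_le_ofReal (h L)
  have hle : μ (⋂ L : ℕ, (FarEv L ∩ good)) ≤ μ (percolatesAt (0 : Site 3)) := measure_mono iInter_farEv_subset
  have : η ≤ theta (zdGraph 3) (0 : Site 3) p := by
    rw [theta, ← hμ, measureReal_def, ← ENNReal.ofReal_le_iff_le_toReal (measure_ne_top _ _)]
    exact hge.trans hle
  exact hη.trans_le this

/-! ### The theorem -/

/-- **`p_c(ℤ³, 0) < p_c(ℋ_n, o)` for `n ≥ 3`** — Martineau–Severo's Theorem 2.1 for the covering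
`ℤ³ → C_n □ ℤ²`, proved along §4: with `p_c := p_c(ℋ_n, o) ∈ (0, 1)`, choose `s' > 0` small and
`p₀ > p_c` close to `p_c`, put `p' = p₀ - κ s' < p_c`; then for every `L`,
`P_{p'}^{ℤ³}(FarEv L) ≥ Θ_L(p', p'^{8n}) ≥ Θ_L(p', s') ≥ Θ_L(p₀, 0) ≥ θ_ℋ(p₀) > 0`
(Propositions 4.1 and 4.2), whence `θ_{ℤ³}(p') > 0` and `p_c(ℤ³) ≤ p' < p_c(ℋ_n)`.
[cite: MartineauSevero2019, §2 Thm. 2.1, §4 (proof)] -/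
theorem criticalProb_zd3_lt_origin (hn : 3 ≤ n) :
    criticalProb (zdGraph 3) (0 : Site 3) < criticalProb (slabTorusGraph n) (origin n) := by
  haveI : NeZero n := ⟨by omega⟩
  have hn1 : n ≠ 1 := by omega
  set pc : ℝ := criticalProb (slabTorusGraph n) (origin n) with hpc
  -- `0 < pc < 1`
  have hpc_pos : 0 < pc := by
    have h3 : 0 < criticalProb (zdGraph 3) (0 : Site 3) := criticalProb_zd_pos 3 (by norm_num)
    refine h3.trans_le (criticalProb_le_of_theta_pos_imp fun p hp => ?_)
    -- the coupling at `s = 0`: `θ_ℋ(p) ≤ Θ_L(p,0) ≤ Θ_L(p, p^T) ≤ P(FarEv L)` for all `L`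
    refine theta_zd3_pos_of p hp fun L => ?_
    calc theta (slabTorusGraph n) (origin n) p ≤ Theta n L p 0 := theta_le_theta_zero hn1 L p
      _ ≤ Theta n L p ((p : ℝ) ^ (8 * n)) :=
          theta_mono_s L p.2.1 p.2.2 le_rfl (pow_nonneg p.2.1 _) (pow_le_one₀ p.2.1 p.2.2)
      _ ≤ _ := theta_le_measureReal_far hn1 L p
  have hpc_lt : pc < 1 := (criticalProb_le_half n).trans_lt (by norm_num)
  -- the constants
  set μ₀ : ℝ := min (pc / 2) ((1 - pc) / 4) with hμ₀
  have hμ₀_pos : 0 < μ₀ := lt_min (by linarith) (by linarith)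
  have hμ₀_le : μ₀ ≤ 1 := (min_le_left _ _).trans (by linarith)
  set C : ℝ := AGconst n μ₀ with hC
  have hC_pos : 0 < C := by
    rw [hC, AGconst]
    have : (0 : ℝ) < n := by exact_mod_cast (show 0 < n by omega)
    positivity
  set κ : ℝ := 1 / C with hκ
  have hκ_pos : 0 < κ := by rw [hκ]; positivity
  have hκC : κ * C ≤ 1 := by rw [hκ, one_div, inv_mul_cancel₀ hC_pos.ne']
  set T : ℕ := 8 * n with hT
  set s' : ℝ := min (1 / 2) (min (pc / (2 * κ)) ((pc / 2) ^ T)) with hs'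
  have hs'_pos : 0 < s' := lt_min (by norm_num) (lt_min (by positivity) (by positivity))
  have hs'_half : s' ≤ 1 / 2 := min_le_left _ _
  have hκs' : κ * s' ≤ pc / 2 := by
    have : s' ≤ pc / (2 * κ) := (min_le_right _ _).trans (min_le_left _ _)
    calc κ * s' ≤ κ * (pc / (2 * κ)) := mul_le_mul_of_nonneg_left this hκ_pos.le
      _ = pc / 2 := by field_simp
  have hs'_pow : s' ≤ (pc / 2) ^ T := (min_le_right _ _).trans (min_le_right _ _)
  set p₀ : ℝ := pc + min (κ * s' / 2) ((1 - pc) / 2) with hp₀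
  have hp₀_gt : pc < p₀ := by
    rw [hp₀]; have : 0 < min (κ * s' / 2) ((1 - pc) / 2) := lt_min (by positivity) (by linarith); linarith
  have hp₀_lt : p₀ < pc + κ * s' := by
    rw [hp₀]; have : min (κ * s' / 2) ((1 - pc) / 2) ≤ κ * s' / 2 := min_le_left _ _
    have : 0 < κ * s' := by positivity
    linarith
  have hp₀_le : p₀ ≤ (1 + pc) / 2 := by
    rw [hp₀]; have := min_le_right (κ * s' / 2) ((1 - pc) / 2); linarith
  have hp₀_le1 : p₀ ≤ 1 := hp₀_le.trans (by linarith)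
  set p' : ℝ := p₀ - κ * s' with hp'
  have hp'_lt : p' < pc := by rw [hp']; linarith
  have hp'_ge : pc / 2 ≤ p' := by rw [hp']; linarith
  have hp'_pos : 0 < p' := by linarith
  have hp'_le1 : p' ≤ 1 := by rw [hp']; nlinarith
  have hμ₀p' : μ₀ ≤ p' := (min_le_left _ _).trans hp'_ge
  have hμ₀p₀ : p₀ ≤ 1 - μ₀ := by
    have : μ₀ ≤ (1 - pc) / 4 := min_le_right _ _
    linarith
  -- `θ_ℋ(p₀) > 0`
  set P₀ : unitInterval := ⟨p₀, by linarith, hp₀_le1⟩ with hP₀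
  have hθ₀ : 0 < theta (slabTorusGraph n) (origin n) P₀ :=
    theta_pos_of_criticalProb_lt_holds (slabTorusGraph n) (origin n) P₀ (by simpa [hP₀] using hp₀_gt)
  -- the chain of inequalities, for every `L`
  set P' : unitInterval := ⟨p', hp'_pos.le, hp'_le1⟩ with hP'
  have hs'_le_pow : s' ≤ p' ^ T := hs'_pow.trans (pow_le_pow_left₀ (by linarith) hp'_ge T)
  have hchain : ∀ L : ℕ, theta (slabTorusGraph n) (origin n) P₀ ≤ (bondPercolation (zdGraph 3) P').real (FarEv L) := by
    intro L
    calc theta (slabTorusGraph n) (origin n) P₀ ≤ Theta n L p₀ 0 := theta_le_theta_zero hn1 L P₀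
      _ ≤ Theta n L (p₀ - κ * s') s' :=
          theta_line_mono hn L hμ₀_pos hμ₀_le hκ_pos.le hκC hs'_pos.le hs'_half hμ₀p' hμ₀p₀
      _ = Theta n L p' s' := by rw [hp']
      _ ≤ Theta n L p' (p' ^ T) := theta_mono_s L hp'_pos.le hp'_le1 hs'_pos.le hs'_le_pow (pow_le_one₀ hp'_pos.le hp'_le1)
      _ = Theta n L P' ((P' : ℝ) ^ (8 * n)) := by rw [hP', hT]
      _ ≤ _ := theta_le_measureReal_far hn1 L P'
  -- conclusion
  have hθ3 : 0 < theta (zdGraph 3) (0 : Site 3) P' := theta_zd3_pos_of P' hθ₀ hchain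
  have hle : criticalProb (zdGraph 3) (0 : Site 3) ≤ p' := by
    refine csInf_le ⟨0, ?_⟩ (Or.inl ⟨P'.2, by simpa using hθ3⟩)
    rintro q (⟨hq, -⟩ | hq)
    · exact hq.1
    · rw [Set.mem_singleton_iff] at hq
      rw [hq]; exact zero_le_one
  exact hle.trans_lt hp'_lt

end SlabTorus

open SlabTorus in
/-- **Martineau–Severo 2019, Corollary 2.2 for `ℤ³ → ℤ³/nℤe₀ = C_n □ ℤ²` (`n ≥ 3`):
`p_c(ℤ³) < p_c(C_n □ ℤ²)`** — discharge of the named fact `martineauSevero_zd3_slabTorus`.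

Proof (Martineau–Severo, Ann. Probab. 47 (2019), Thm. 2.1 via §4): the enhanced
(`(p, s)`-column) percolation on `ℋ_n = C_n □ ℤ²` is (i) stochastically below the `p`-cluster of
the lift in `ℤ³` for `s = p^{8n}` (Prop. 4.1: lifted exploration, `QSMExploration.lean`,
`QSMStatic.lean`, `QSMLiftDefs.lean`, `QSMLift.lean`) and (ii) percolating for some `p < p_c(ℋ_n)`
for every `s > 0` (Prop. 4.2: Aizenman–Grimmett differential inequality from Lemma 6.1,
`QSMLocalModification.lean`, `QSMPolynomials.lean`); hence `θ_{ℤ³}(p) > 0` for some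
`p < p_c(ℋ_n)`. The base point of `ℋ_n` is arbitrary since `ℋ_n` is connected.
[cite: MartineauSevero2019, Cor. 2.2 (with Thm. 2.1, §4–§6)] -/
theorem martineauSevero_zd3_slabTorus_holds : martineauSevero_zd3_slabTorus := by
  intro n hn v
  haveI : NeZero n := ⟨by omega⟩
  rw [← criticalProb_eq_of_reachable (slabTorusGraph n) (reachable_origin (by omega) v)]
  exact criticalProb_zd3_lt_origin hn

end Literature.Probability.Percolation
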